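import Summits.HodgeConjecture.HodgeConjecture.Theses.HeckePrymWeil
import Summits.HodgeConjecture.HodgeConjecture.Theorems.HeckePrymWeilWeilTwelvefoldsSqrtMinus7OfDeligneWeilFamily
import HarnessLib

/-!
# `FamilySectorGlue` (route `HeckePrymWeil`, item stmt-HodgeConjecture-17036) — proved

The support item `FamilySectorGlue` of route `HeckePrymWeil` (sub-problem `HodgeConjecture`):

  `DeligneWeilFamily → WeilVariationalHodge →` (for every prime `p ≡ 3 (4)`, `p ≥ 7`, and every `n ≥ 1`,
  every rational `(n,n)`-class in the typed Weil plane of every abelian `2n`-fold `(A, φ)` with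
  `φ ≫ φ = -p` is algebraic),

i.e. the whole `ℚ(√-p)` Hodge–Weil sector from the two route items `DeligneWeilFamily`
(stmt-HodgeConjecture-16866) and `WeilVariationalHodge` (stmt-HodgeConjecture-14497).  Its consequent is
verbatim the antecedent of `SummitOffWeilSector`, so the deciding theorem composes as `hS (hG hF hV)`.

PROOF.  Pure composition: the landed theorem
`Theorems.HeckePrymWeilLine.hodgeWeil_of_weilVariationalHodge_of_deligneWeilFamily`
(file `Theorems/HeckePrymWeilWeilTwelvefoldsSqrtMinus7OfDeligneWeilFamily.lean`) takes as first hypothesis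
the `δ`-unfolding of the route decl `DeligneWeilFamily` and as second the route decl `WeilVariationalHodge`,
and concludes the consequent verbatim (item ⟹ `deligne1982_weilFamily_kAction` ⟹ flat fibrewise-Hodge Weil
section with tensor-split fibre ⟹ `HWA(p, k)` by Weil transport at `M = k` and return along the chart).
[cite: Deligne1982HodgeCycles, proof of Thm. 4.8 with Prop. 4.4, Lemma 4.5] [cite: Grothendieck1966, footnote 13]

No new definition, no `sorry`; axioms `propext`, `Classical.choice`, `Quot.sound`.
-/

-- every declaration of this problem lives in `Summit.HodgeConjecture.HodgeConjecture.…` (summit = sub-problem)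
set_option linter.dupNamespace false

namespace Summit.HodgeConjecture.HodgeConjecture.Theorems

open Summit.HodgeConjecture.HodgeConjecture.Theses.HeckePrymWeil

/-- **`FamilySectorGlue` holds** (item stmt-HodgeConjecture-17036, route `HeckePrymWeil`, support):
`DeligneWeilFamily → WeilVariationalHodge →` the whole `ℚ(√-p)` Hodge–Weil sector (every rational
`(n,n)`-class of the typed Weil plane of every abelian `2n`-fold `(A, φ)` with `φ ≫ φ = -p`, `p ≡ 3 (4)` prime
`≥ 7`, `n ≥ 1`, is algebraic).  One-line composition with
`Theorems.HeckePrymWeilLine.hodgeWeil_of_weilVariationalHodge_of_deligneWeilFamily`, whose hypotheses are the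
`δ`-unfoldings of the two route decls and whose conclusion is the consequent verbatim.
[cite: Deligne1982HodgeCycles, proof of Thm. 4.8 with Prop. 4.4, Lemma 4.5] [cite: Grothendieck1966, footnote 13] -/
theorem familySectorGlue_proof : FamilySectorGlue := by
  unfold FamilySectorGlue
  intro hF hV
  exact HeckePrymWeilLine.hodgeWeil_of_weilVariationalHodge_of_deligneWeilFamily hF hV

end Summit.HodgeConjecture.HodgeConjecture.Theorems
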